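/-
Copyright (c) 2026 the pub-hodgecm-mathlib formalisation cell (harness21).  Prover seat hodgecm-mathlib-K2Liu-p03 (g5): Track B «K2-LIT»,
#184♮ = hLiu418 = stmt-HodgeConjecture-24832; Road Φ of socket #41, organ Φ3b (LEAD F0P6-plan (g11) ruling «M-155l» (3c)).
-/
import Summits.HodgeConjecture.HodgeConjecture.Theorems.K2LiuSiegelUnipotentLocalDefs   -- DEFS leaf 1: `unipDeltaLoc ∕ Fin ∕ Arch`, componentwise membership
import Literature.Topology.Algebra.RestrictedProduct.Cutout                             -- ★ `cutout`, `inH`, `cutoutEquiv` (fibrewise cut-out of a restricted product)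
import HarnessLib

/-!
# Crux `HLiu418`, Road Φ of socket #41, organ Φ3b — DEFS LEAF 2: the topological splitting
# `N_Δ(𝔸) ≃ₜ* N_Δ(L⁺ ⊗ ℝ) × ∏'_v [N_Δ(L⁺_v), K_{H,v} ∩ N_Δ(L⁺_v)]` of the Siegel unipotent radical

Cell `hodgecm-mathlib`, crux item hLiu418 = `stmt-HodgeConjecture-24832`, route of record `HCCMUnconditional`; squad K2 ∕ K2Liu, road `K2_Liu`,
socket #41 `sig_K2LiuSiegelEisensteinContinuation`, Road Φ, organ Φ3b «`N_Δ(𝔸)` as a restricted product» (census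
`K2/K2Liu-p03/g5/CENSUS-PHI3-PureTensorEuler…md` §1 row Φ3b).  DEFINITIONS WITH BODIES + their algebra (the cell's DEFS lane); no `instance`, no
`notation`, no named-fact hypothesis, no `sorry`; lane `--supports stmt-HodgeConjecture-24832`.

CONTENTS.  Over DEFS leaf 1 (`mem_unipDelta_iff_archPart_finPart`, `mem_unipDeltaFin_iff_forall_evalPlace`):
* `unipDeltaFinSplit : N_Δ(𝔸_f) ≃ₜ* ∏'_v [N_Δ(L⁺_v), K_{H,v} ∩ N_Δ(L⁺_v)]` — ★ `finAdelicEquiv : H(𝔸_f) ≃ₜ* ∏'_v [H(L⁺_v), K_{H,v}]` restricted to the subgroup cut out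
  placewise by the `N_Δ(L⁺_v)`, then ★ `RestrictedProduct.cutoutEquiv` (a fibrewise cut-out of a restricted product is the restricted product of the fibres);
  assembled from NAMED maps `unipDeltaFinSplitFun ∕ Inv` with their inverse, multiplicativity and continuity lemmas (the generic ★
  `ContinuousMulEquiv.restrictSubgroup` makes the unifier time out against the declared type on the nested subtype `↥N_Δ(𝔸_f) ≤ ↥H(𝔸_f)`);
* `unipDeltaSplit : N_Δ(𝔸) ≃ₜ* N_Δ(L⁺ ⊗ ℝ) × ∏'_v [N_Δ(L⁺_v), K_{H,v} ∩ N_Δ(L⁺_v)]`, `u ↦ (u_∞, (u_v)_v)`, inverse `(a, y) ↦ (a, 1)·(1, unipDeltaFinSplit⁻¹ y)`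
  (★ `adelicProdEquiv` restricted along `mem_unipDelta_iff_archPart_finPart`), again from named maps `unipDeltaSplitFun ∕ Inv`;
* coordinate lemmas (`rfl`): `coe_unipDeltaFinSplit_apply`, `evalPlace_unipDeltaFinSplit_symm`, `coe_unipDeltaSplit_fst`, `coe_unipDeltaSplit_snd_apply`,
  `coe_unipDeltaSplit_symm_apply`.
This is the input of the Haar pinning `νN = ν_∞ ⊗ ⊗_{v∈S} ν_v ⊗ ∏'_{v∉S}(ν_v; N_Δ(𝒪_v))` (Haar uniqueness on the product; ★ `K2LiuDoublingHaarPinned` pattern)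
and of the Euler product of ★ `whittakerDelta` (Φ3d).  Heartbeat notes: three lemmas carry MEASURED `maxHeartbeats 800000` ∕ `synthInstance.maxHeartbeats
200000` (the instance tower `↥N_Δ(L⁺_v) ≤ ↥H(L⁺_v) ≤ ∏_{w∣v} GL_{2n}(L_w)` under the `∀ v` binder of the restricted product; plain `rw`∕`exact`, no search tactics).
[cite: BorelJacquet1979, §4.1 (`G(𝔸) = G_∞ × G(𝔸_f)`, `G(𝔸_f) = ∏'_v G(F_v)`)] [cite: MoeglinWaldspurger1995, I.2.1] [cite: Tan1999, §2 (`M(s) = ⊗_v M_v(s)`)]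

HONEST LABEL.  Carriers only; `HC_CM` is proved only modulo the 7 printed citations (2 remaining named inputs: hLiu418 = 24832, h413 = 24833) until rung 0
closes; this file is a helper (`--supports stmt-HodgeConjecture-24832`) and closes no socket by itself.

## References
* [BorelJacquet1979] A. Borel, H. Jacquet, PSPM 33.1 (1979), §4.1.
* [MoeglinWaldspurger1995] C. Mœglin, J.-L. Waldspurger, *Spectral decomposition and Eisenstein series*, CUP (1995): I.2.1.
* [Tan1999] V. Tan, *Poles of Siegel Eisenstein series on U(n,n)*, Canad. J. Math. 51 (1999), §2.
-/

set_option autoImplicit false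
-- the mandated namespace repeats the single-problem summit's segment (`HodgeConjecture.HodgeConjecture`)
set_option linter.dupNamespace false

noncomputable section

open scoped Matrix RestrictedProduct
open NumberField IsDedekindDomain

namespace Summit.HodgeConjecture.HodgeConjecture.Cruxes.HLiu418.K2LiuSiegelUnipotentSplitDefs

open Literature.NumberTheory.Automorphic Literature.NumberTheory.GaloisRepresentations
open Literature.NumberTheory.GelbartRogawski1991 Literature.NumberTheory.GelbartRogawski1991.GRConstruction
open Literature.NumberTheory.K2Lit.SiegelDoubled
open Literature.Topology.Algebra.RestrictedProduct (cutout inH cutoutEquiv)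
open Summit.HodgeConjecture.HodgeConjecture.Cruxes.HLiu418.K2LiuSiegelUnipotentLocalDefs

variable (L : Type) [Field L] [NumberField L] [IsCMField L]
variable {N M n : ℕ} (e : Fin N × Fin M ≃ Fin n)
  (dV : Fin N → L) (hdV : ∀ i, IsCMField.complexConj L (dV i) = dV i)
  (dW : Fin M → L) (hdW : ∀ i, IsCMField.complexConj L (dW i) = dW i)

/-! ## §4 The topological splitting `N_Δ(𝔸) ≃ₜ* N_Δ(L⁺ ⊗ ℝ) × ∏'_v [N_Δ(L⁺_v), K_{H,v} ∩ N_Δ(L⁺_v)]` -/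

/-- `N_Δ(𝔸_f)` is the pull-back along ★ `finAdelicEquiv` of the fibrewise cut-out of `∏'_v [H(L⁺_v), K_{H,v}]` by the `N_Δ(L⁺_v)` (the shape ★
`ContinuousMulEquiv.restrictSubgroup` consumes; `(finAdelicEquiv b) v = evalPlace v b` by `rfl`). [cite: BorelJacquet1979, §4.1] -/
theorem mem_unipDeltaFin_iff_finAdelicEquiv_mem_cutout
    (b : UnitaryGroup.finAdelic (Fp L) L (IsCMField.complexConj L) (n + n) (hermD L e dV hdV dW hdW)) :
    b ∈ unipDeltaFin L e dV hdV dW hdW ↔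
      UnitaryGroup.finAdelicEquiv (Fp L) L (IsCMField.complexConj L) (n + n) (hermD L e dV hdV dW hdW) b ∈
        cutout (fun v => UnitaryGroup.localInt L (IsCMField.complexConj L) (n + n) (hermD L e dV hdV dW hdW) v)
          (fun v => unipDeltaLoc L e dV hdV dW hdW v) := by
  rw [Literature.Topology.Algebra.RestrictedProduct.mem_cutout_iff]
  exact mem_unipDeltaFin_iff_forall_evalPlace L e dV hdV dW hdW b

/-- the forward map of `unipDeltaFinSplit`: `b ↦ (b_v)_v` (★ `finAdelicEquiv` then ★ `cutoutEquiv⁻¹`). [cite: BorelJacquet1979, §4.1] -/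
def unipDeltaFinSplitFun (b : ↥(unipDeltaFin L e dV hdV dW hdW)) :
    Πʳ v : HeightOneSpectrum (𝓞 (Fp L)),
        [↥(unipDeltaLoc L e dV hdV dW hdW v),
          inH (fun v => UnitaryGroup.localInt L (IsCMField.complexConj L) (n + n) (hermD L e dV hdV dW hdW) v)
            (fun v => unipDeltaLoc L e dV hdV dW hdW v) v] :=
  (cutoutEquiv (fun v => UnitaryGroup.localInt L (IsCMField.complexConj L) (n + n) (hermD L e dV hdV dW hdW) v)
      (fun v => unipDeltaLoc L e dV hdV dW hdW v)).symm
    ⟨(UnitaryGroup.finAdelicEquiv (Fp L) L (IsCMField.complexConj L) (n + n) (hermD L e dV hdV dW hdW)) b.1, (mem_unipDeltaFin_iff_finAdelicEquiv_mem_cutout L e dV hdV dW hdW b.1).1 b.2⟩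

/-- the backward map of `unipDeltaFinSplit`: `y ↦ finAdelicEquiv⁻¹ (cutoutEquiv y)`. [cite: BorelJacquet1979, §4.1] -/
def unipDeltaFinSplitInv
    (y : Πʳ v : HeightOneSpectrum (𝓞 (Fp L)),
        [↥(unipDeltaLoc L e dV hdV dW hdW v),
          inH (fun v => UnitaryGroup.localInt L (IsCMField.complexConj L) (n + n) (hermD L e dV hdV dW hdW) v)
            (fun v => unipDeltaLoc L e dV hdV dW hdW v) v]) :
    ↥(unipDeltaFin L e dV hdV dW hdW) :=
  ⟨(UnitaryGroup.finAdelicEquiv (Fp L) L (IsCMField.complexConj L) (n + n) (hermD L e dV hdV dW hdW)).symm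
      (cutoutEquiv (fun v => UnitaryGroup.localInt L (IsCMField.complexConj L) (n + n) (hermD L e dV hdV dW hdW) v)
        (fun v => unipDeltaLoc L e dV hdV dW hdW v) y).1,
    (mem_unipDeltaFin_iff_finAdelicEquiv_mem_cutout L e dV hdV dW hdW _).2 (by
      rw [ContinuousMulEquiv.apply_symm_apply]
      exact (cutoutEquiv (fun v => UnitaryGroup.localInt L (IsCMField.complexConj L) (n + n) (hermD L e dV hdV dW hdW) v)
        (fun v => unipDeltaLoc L e dV hdV dW hdW v) y).2)⟩

set_option synthInstance.maxHeartbeats 200000 in -- MEASURED: the instance tower `↥(unipDeltaLoc v) ≤ ↥H(L⁺_v) ≤ ∏_w GL` under the `∀ v` binder of the restricted product exceeds the default 20000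
set_option maxHeartbeats 800000 in -- MEASURED: same tower inside `cutoutEquiv`'s `apply_symm_apply` ∕ `map_mul` unification
/-- `unipDeltaFinSplitInv ∘ unipDeltaFinSplitFun = id`. [cite: BorelJacquet1979, §4.1] -/
theorem unipDeltaFinSplitInv_fun (b : ↥(unipDeltaFin L e dV hdV dW hdW)) :
    unipDeltaFinSplitInv L e dV hdV dW hdW (unipDeltaFinSplitFun L e dV hdV dW hdW b) = b := by
  refine Subtype.ext ?_
  unfold unipDeltaFinSplitInv unipDeltaFinSplitFun
  dsimp only
  rw [ContinuousMulEquiv.apply_symm_apply]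
  exact (UnitaryGroup.finAdelicEquiv (Fp L) L (IsCMField.complexConj L) (n + n) (hermD L e dV hdV dW hdW)).symm_apply_apply b.1

set_option synthInstance.maxHeartbeats 200000 in -- MEASURED: the instance tower `↥(unipDeltaLoc v) ≤ ↥H(L⁺_v) ≤ ∏_w GL` under the `∀ v` binder of the restricted product exceeds the default 20000
set_option maxHeartbeats 800000 in -- MEASURED: same tower inside `cutoutEquiv`'s `apply_symm_apply` ∕ `map_mul` unification
/-- `unipDeltaFinSplitFun ∘ unipDeltaFinSplitInv = id`. [cite: BorelJacquet1979, §4.1] -/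
theorem unipDeltaFinSplitFun_inv
    (y : Πʳ v : HeightOneSpectrum (𝓞 (Fp L)),
        [↥(unipDeltaLoc L e dV hdV dW hdW v),
          inH (fun v => UnitaryGroup.localInt L (IsCMField.complexConj L) (n + n) (hermD L e dV hdV dW hdW) v)
            (fun v => unipDeltaLoc L e dV hdV dW hdW v) v]) :
    unipDeltaFinSplitFun L e dV hdV dW hdW (unipDeltaFinSplitInv L e dV hdV dW hdW y) = y := by
  unfold unipDeltaFinSplitInv unipDeltaFinSplitFun
  apply EquivLike.injective
    (cutoutEquiv (fun v => UnitaryGroup.localInt L (IsCMField.complexConj L) (n + n) (hermD L e dV hdV dW hdW) v)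
      (fun v => unipDeltaLoc L e dV hdV dW hdW v))
  rw [ContinuousMulEquiv.apply_symm_apply]
  exact Subtype.ext (ContinuousMulEquiv.apply_symm_apply _ _)

set_option synthInstance.maxHeartbeats 200000 in -- MEASURED: the instance tower `↥(unipDeltaLoc v) ≤ ↥H(L⁺_v) ≤ ∏_w GL` under the `∀ v` binder of the restricted product exceeds the default 20000
set_option maxHeartbeats 800000 in -- MEASURED: same tower inside `cutoutEquiv`'s `apply_symm_apply` ∕ `map_mul` unification
/-- `unipDeltaFinSplitFun` is multiplicative. [cite: BorelJacquet1979, §4.1] -/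
theorem unipDeltaFinSplitFun_mul (b b' : ↥(unipDeltaFin L e dV hdV dW hdW)) :
    unipDeltaFinSplitFun L e dV hdV dW hdW (b * b') = unipDeltaFinSplitFun L e dV hdV dW hdW b * unipDeltaFinSplitFun L e dV hdV dW hdW b' := by
  unfold unipDeltaFinSplitFun
  rw [← map_mul]
  congr 1
  exact Subtype.ext (map_mul _ _ _)

set_option maxHeartbeats 400000 in
/-- `unipDeltaFinSplitFun` is continuous. [cite: BorelJacquet1979, §4.1] -/
theorem continuous_unipDeltaFinSplitFun : Continuous (unipDeltaFinSplitFun L e dV hdV dW hdW) :=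
  (cutoutEquiv (fun v => UnitaryGroup.localInt L (IsCMField.complexConj L) (n + n) (hermD L e dV hdV dW hdW) v)
      (fun v => unipDeltaLoc L e dV hdV dW hdW v)).symm.continuous.comp
    (((UnitaryGroup.finAdelicEquiv (Fp L) L (IsCMField.complexConj L) (n + n) (hermD L e dV hdV dW hdW)).continuous.comp continuous_subtype_val).subtype_mk _)

/-- `unipDeltaFinSplitInv` is continuous. [cite: BorelJacquet1979, §4.1] -/
theorem continuous_unipDeltaFinSplitInv : Continuous (unipDeltaFinSplitInv L e dV hdV dW hdW) :=
  ((UnitaryGroup.finAdelicEquiv (Fp L) L (IsCMField.complexConj L) (n + n) (hermD L e dV hdV dW hdW)).symm.continuous.comp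
    (continuous_subtype_val.comp
      (cutoutEquiv (fun v => UnitaryGroup.localInt L (IsCMField.complexConj L) (n + n) (hermD L e dV hdV dW hdW) v)
        (fun v => unipDeltaLoc L e dV hdV dW hdW v)).continuous)).subtype_mk _

/-- **THE FINITE PART AS A RESTRICTED PRODUCT: `N_Δ(𝔸_f) ≃ₜ* ∏'_v [N_Δ(L⁺_v), K_{H,v} ∩ N_Δ(L⁺_v)]`** as topological groups — the restriction of
★ `finAdelicEquiv : H(𝔸_f) ≃ₜ* ∏'_v [H(L⁺_v), K_{H,v}]` to the subgroup cut out placewise by the `N_Δ(L⁺_v)` (`mem_unipDeltaFin_iff_forall_evalPlace`),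
followed by ★ `cutoutEquiv` (a fibrewise cut-out of a restricted product is the restricted product of the fibres); assembled from the named maps above
(the generic ★ `ContinuousMulEquiv.restrictSubgroup` makes the unifier time out on the nested subtype `↥N_Δ(𝔸_f) ≤ ↥H(𝔸_f)`).
[cite: BorelJacquet1979, §4.1] [cite: Tan1999, §2] -/
def unipDeltaFinSplit :
    ↥(unipDeltaFin L e dV hdV dW hdW) ≃ₜ*
      Πʳ v : HeightOneSpectrum (𝓞 (Fp L)),
        [↥(unipDeltaLoc L e dV hdV dW hdW v),
          inH (fun v => UnitaryGroup.localInt L (IsCMField.complexConj L) (n + n) (hermD L e dV hdV dW hdW) v)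
            (fun v => unipDeltaLoc L e dV hdV dW hdW v) v] where
  toFun := unipDeltaFinSplitFun L e dV hdV dW hdW
  invFun := unipDeltaFinSplitInv L e dV hdV dW hdW
  left_inv := unipDeltaFinSplitInv_fun L e dV hdV dW hdW
  right_inv := unipDeltaFinSplitFun_inv L e dV hdV dW hdW
  map_mul' := unipDeltaFinSplitFun_mul L e dV hdV dW hdW
  continuous_toFun := continuous_unipDeltaFinSplitFun L e dV hdV dW hdW
  continuous_invFun := continuous_unipDeltaFinSplitInv L e dV hdV dW hdW

/-- coordinates of `unipDeltaFinSplit`: the `v`-component is `b_v` = ★ `evalPlace v b` (definitional). [cite: BorelJacquet1979, §4.1] -/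
@[simp] theorem coe_unipDeltaFinSplit_apply (b : ↥(unipDeltaFin L e dV hdV dW hdW)) (v : HeightOneSpectrum (𝓞 (Fp L))) :
    ((unipDeltaFinSplit L e dV hdV dW hdW b v : ↥(unipDeltaLoc L e dV hdV dW hdW v)) :
        UnitaryGroup.localPi L (IsCMField.complexConj L) (n + n) (hermD L e dV hdV dW hdW) v) =
      UnitaryGroup.evalPlace (Fp L) L (IsCMField.complexConj L) (n + n) (hermD L e dV hdV dW hdW) v
        (b : UnitaryGroup.finAdelic (Fp L) L (IsCMField.complexConj L) (n + n) (hermD L e dV hdV dW hdW)) :=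
  rfl

set_option synthInstance.maxHeartbeats 200000 in -- MEASURED: the instance tower `↥(unipDeltaLoc v) ≤ ↥H(L⁺_v) ≤ ∏_w GL` under the `∀ v` binder of the restricted product exceeds the default 20000
/-- the inverse of `unipDeltaFinSplit` has the prescribed components: `evalPlace v (unipDeltaFinSplit⁻¹ y) = y_v`. [cite: BorelJacquet1979, §4.1] -/
theorem evalPlace_unipDeltaFinSplit_symm
    (y : Πʳ v : HeightOneSpectrum (𝓞 (Fp L)),
        [↥(unipDeltaLoc L e dV hdV dW hdW v),
          inH (fun v => UnitaryGroup.localInt L (IsCMField.complexConj L) (n + n) (hermD L e dV hdV dW hdW) v)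
            (fun v => unipDeltaLoc L e dV hdV dW hdW v) v])
    (v : HeightOneSpectrum (𝓞 (Fp L))) :
    UnitaryGroup.evalPlace (Fp L) L (IsCMField.complexConj L) (n + n) (hermD L e dV hdV dW hdW) v
        (((unipDeltaFinSplit L e dV hdV dW hdW).symm y : ↥(unipDeltaFin L e dV hdV dW hdW)) :
          UnitaryGroup.finAdelic (Fp L) L (IsCMField.complexConj L) (n + n) (hermD L e dV hdV dW hdW)) =
      ((y v : ↥(unipDeltaLoc L e dV hdV dW hdW v)) : UnitaryGroup.localPi L (IsCMField.complexConj L) (n + n) (hermD L e dV hdV dW hdW) v) := by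
  have h := coe_unipDeltaFinSplit_apply L e dV hdV dW hdW ((unipDeltaFinSplit L e dV hdV dW hdW).symm y) v
  rw [ContinuousMulEquiv.apply_symm_apply] at h
  exact h.symm

/-- the forward map of `unipDeltaSplit`: `u ↦ (u_∞, (u_v)_v)`. [cite: BorelJacquet1979, §4.1] -/
def unipDeltaSplitFun (u : ↥(unipDelta L e dV hdV dW hdW)) :
    ↥(unipDeltaArch L e dV hdV dW hdW) ×
      Πʳ v : HeightOneSpectrum (𝓞 (Fp L)),
        [↥(unipDeltaLoc L e dV hdV dW hdW v),
          inH (fun v => UnitaryGroup.localInt L (IsCMField.complexConj L) (n + n) (hermD L e dV hdV dW hdW) v)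
            (fun v => unipDeltaLoc L e dV hdV dW hdW v) v] :=
  (⟨UnitaryGroup.archPart (Fp L) L (IsCMField.complexConj L) (n + n) (hermD L e dV hdV dW hdW) u.1,
      ((mem_unipDelta_iff_archPart_finPart L e dV hdV dW hdW u.1).1 u.2).1⟩,
    unipDeltaFinSplitFun L e dV hdV dW hdW
      ⟨UnitaryGroup.finPart (Fp L) L (IsCMField.complexConj L) (n + n) (hermD L e dV hdV dW hdW) u.1,
        ((mem_unipDelta_iff_archPart_finPart L e dV hdV dW hdW u.1).1 u.2).2⟩)

/-- the backward map of `unipDeltaSplit`: `(a, y) ↦ (a, 1)·(1, unipDeltaFinSplit⁻¹ y)`. [cite: BorelJacquet1979, §4.1] -/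
def unipDeltaSplitInv
    (p : ↥(unipDeltaArch L e dV hdV dW hdW) ×
      Πʳ v : HeightOneSpectrum (𝓞 (Fp L)),
        [↥(unipDeltaLoc L e dV hdV dW hdW v),
          inH (fun v => UnitaryGroup.localInt L (IsCMField.complexConj L) (n + n) (hermD L e dV hdV dW hdW) v)
            (fun v => unipDeltaLoc L e dV hdV dW hdW v) v]) :
    ↥(unipDelta L e dV hdV dW hdW) :=
  ⟨UnitaryGroup.archToAdelic (Fp L) L (IsCMField.complexConj L) (n + n) (hermD L e dV hdV dW hdW) p.1.1 *
      UnitaryGroup.finAdelicToAdelic (Fp L) L (IsCMField.complexConj L) (n + n) (hermD L e dV hdV dW hdW)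
        (unipDeltaFinSplitInv L e dV hdV dW hdW p.2).1,
    (mem_unipDelta_iff_archPart_finPart L e dV hdV dW hdW _).2
      ⟨by
        rw [map_mul, UnitaryGroup.archPart_archToAdelic, UnitaryGroup.archPart_finAdelicToAdelic, mul_one]
        exact p.1.2,
       by
        rw [map_mul, UnitaryGroup.finPart_archToAdelic, UnitaryGroup.finPart_finAdelicToAdelic, one_mul]
        exact (unipDeltaFinSplitInv L e dV hdV dW hdW p.2).2⟩⟩

set_option synthInstance.maxHeartbeats 200000 in -- MEASURED: the instance tower `↥(unipDeltaLoc v) ≤ ↥H(L⁺_v) ≤ ∏_w GL` under the `∀ v` binder of the restricted product exceeds the default 20000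
/-- `unipDeltaSplitInv ∘ unipDeltaSplitFun = id` (★ `archToAdelic_mul_finAdelicToAdelic`). [cite: BorelJacquet1979, §4.1] -/
theorem unipDeltaSplitInv_fun (u : ↥(unipDelta L e dV hdV dW hdW)) :
    unipDeltaSplitInv L e dV hdV dW hdW (unipDeltaSplitFun L e dV hdV dW hdW u) = u := by
  refine Subtype.ext ?_
  unfold unipDeltaSplitInv unipDeltaSplitFun
  dsimp only
  rw [unipDeltaFinSplitInv_fun]
  exact UnitaryGroup.archToAdelic_mul_finAdelicToAdelic (Fp L) L (IsCMField.complexConj L) (n + n) (hermD L e dV hdV dW hdW) u.1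

set_option synthInstance.maxHeartbeats 200000 in -- MEASURED: the instance tower `↥(unipDeltaLoc v) ≤ ↥H(L⁺_v) ≤ ∏_w GL` under the `∀ v` binder of the restricted product exceeds the default 20000
/-- `unipDeltaSplitFun ∘ unipDeltaSplitInv = id`. [cite: BorelJacquet1979, §4.1] -/
theorem unipDeltaSplitFun_inv
    (p : ↥(unipDeltaArch L e dV hdV dW hdW) ×
      Πʳ v : HeightOneSpectrum (𝓞 (Fp L)),
        [↥(unipDeltaLoc L e dV hdV dW hdW v),
          inH (fun v => UnitaryGroup.localInt L (IsCMField.complexConj L) (n + n) (hermD L e dV hdV dW hdW) v)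
            (fun v => unipDeltaLoc L e dV hdV dW hdW v) v]) :
    unipDeltaSplitFun L e dV hdV dW hdW (unipDeltaSplitInv L e dV hdV dW hdW p) = p := by
  unfold unipDeltaSplitFun
  refine Prod.ext (Subtype.ext ?_) ?_
  · change UnitaryGroup.archPart (Fp L) L (IsCMField.complexConj L) (n + n) (hermD L e dV hdV dW hdW) (unipDeltaSplitInv L e dV hdV dW hdW p).1 = p.1.1
    unfold unipDeltaSplitInv
    dsimp only
    rw [map_mul, UnitaryGroup.archPart_archToAdelic, UnitaryGroup.archPart_finAdelicToAdelic, mul_one]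
  · change unipDeltaFinSplitFun L e dV hdV dW hdW _ = p.2
    have h2 : (⟨UnitaryGroup.finPart (Fp L) L (IsCMField.complexConj L) (n + n) (hermD L e dV hdV dW hdW) (unipDeltaSplitInv L e dV hdV dW hdW p).1,
          ((mem_unipDelta_iff_archPart_finPart L e dV hdV dW hdW (unipDeltaSplitInv L e dV hdV dW hdW p).1).1
            (unipDeltaSplitInv L e dV hdV dW hdW p).2).2⟩ : ↥(unipDeltaFin L e dV hdV dW hdW)) =
        unipDeltaFinSplitInv L e dV hdV dW hdW p.2 := by
      refine Subtype.ext ?_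
      unfold unipDeltaSplitInv
      dsimp only
      rw [map_mul, UnitaryGroup.finPart_archToAdelic, UnitaryGroup.finPart_finAdelicToAdelic, one_mul]
    rw [h2, unipDeltaFinSplitFun_inv]

set_option synthInstance.maxHeartbeats 200000 in -- MEASURED: the instance tower `↥(unipDeltaLoc v) ≤ ↥H(L⁺_v) ≤ ∏_w GL` under the `∀ v` binder of the restricted product exceeds the default 20000
/-- `unipDeltaSplitFun` is multiplicative. [cite: BorelJacquet1979, §4.1] -/
theorem unipDeltaSplitFun_mul (u u' : ↥(unipDelta L e dV hdV dW hdW)) :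
    unipDeltaSplitFun L e dV hdV dW hdW (u * u') = unipDeltaSplitFun L e dV hdV dW hdW u * unipDeltaSplitFun L e dV hdV dW hdW u' := by
  unfold unipDeltaSplitFun
  refine Prod.ext (Subtype.ext ?_) ?_
  · change UnitaryGroup.archPart (Fp L) L (IsCMField.complexConj L) (n + n) (hermD L e dV hdV dW hdW) (u.1 * u'.1) =
      UnitaryGroup.archPart (Fp L) L (IsCMField.complexConj L) (n + n) (hermD L e dV hdV dW hdW) u.1 * UnitaryGroup.archPart (Fp L) L (IsCMField.complexConj L) (n + n) (hermD L e dV hdV dW hdW) u'.1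
    exact map_mul _ _ _
  · change unipDeltaFinSplitFun L e dV hdV dW hdW _ = unipDeltaFinSplitFun L e dV hdV dW hdW _ * unipDeltaFinSplitFun L e dV hdV dW hdW _
    rw [← unipDeltaFinSplitFun_mul]
    congr 1
    exact Subtype.ext (map_mul _ u.1 u'.1)

/-- `unipDeltaSplitFun` is continuous. [cite: BorelJacquet1979, §4.1] -/
theorem continuous_unipDeltaSplitFun : Continuous (unipDeltaSplitFun L e dV hdV dW hdW) :=
  (((UnitaryGroup.continuous_archPart (Fp L) L (IsCMField.complexConj L) (n + n) (hermD L e dV hdV dW hdW)).comp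
      continuous_subtype_val).subtype_mk _).prodMk
    ((continuous_unipDeltaFinSplitFun L e dV hdV dW hdW).comp
      (((UnitaryGroup.continuous_finPart (Fp L) L (IsCMField.complexConj L) (n + n) (hermD L e dV hdV dW hdW)).comp
        continuous_subtype_val).subtype_mk _))

/-- `unipDeltaSplitInv` is continuous. [cite: BorelJacquet1979, §4.1] -/
theorem continuous_unipDeltaSplitInv : Continuous (unipDeltaSplitInv L e dV hdV dW hdW) :=
  (((UnitaryGroup.continuous_archToAdelic (Fp L) L (IsCMField.complexConj L) (n + n) (hermD L e dV hdV dW hdW)).comp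
      (continuous_subtype_val.comp continuous_fst)).mul
    ((UnitaryGroup.continuous_finAdelicToAdelic (Fp L) L (IsCMField.complexConj L) (n + n) (hermD L e dV hdV dW hdW)).comp
      (continuous_subtype_val.comp ((continuous_unipDeltaFinSplitInv L e dV hdV dW hdW).comp continuous_snd)))).subtype_mk _

/-- **THE TOPOLOGICAL SPLITTING OF `N_Δ(𝔸)`**: `u ↦ (u_∞, (u_v)_v)` is an isomorphism of topological groups
`N_Δ(𝔸) ≃ₜ* N_Δ(L⁺ ⊗ ℝ) × ∏'_v [N_Δ(L⁺_v), K_{H,v} ∩ N_Δ(L⁺_v)]`, with inverse `(a, y) ↦ (a, 1)·(1, unipDeltaFinSplit⁻¹ y)` — the restriction of ★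
`adelicProdEquiv : H(𝔸) ≃ₜ* H_∞ × H(𝔸_f)` (`mem_unipDelta_iff_archPart_finPart`) followed by `unipDeltaFinSplit` on the second factor.
[cite: BorelJacquet1979, §4.1] [cite: MoeglinWaldspurger1995, I.2.1] [cite: Tan1999, §2] -/
def unipDeltaSplit :
    ↥(unipDelta L e dV hdV dW hdW) ≃ₜ*
      ↥(unipDeltaArch L e dV hdV dW hdW) ×
        Πʳ v : HeightOneSpectrum (𝓞 (Fp L)),
        [↥(unipDeltaLoc L e dV hdV dW hdW v),
          inH (fun v => UnitaryGroup.localInt L (IsCMField.complexConj L) (n + n) (hermD L e dV hdV dW hdW) v)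
            (fun v => unipDeltaLoc L e dV hdV dW hdW v) v] where
  toFun := unipDeltaSplitFun L e dV hdV dW hdW
  invFun := unipDeltaSplitInv L e dV hdV dW hdW
  left_inv := unipDeltaSplitInv_fun L e dV hdV dW hdW
  right_inv := unipDeltaSplitFun_inv L e dV hdV dW hdW
  map_mul' := unipDeltaSplitFun_mul L e dV hdV dW hdW
  continuous_toFun := continuous_unipDeltaSplitFun L e dV hdV dW hdW
  continuous_invFun := continuous_unipDeltaSplitInv L e dV hdV dW hdW

/-- coordinates of `unipDeltaSplit`, archimedean: `(unipDeltaSplit u).1 = u_∞`. [cite: BorelJacquet1979, §4.1] -/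
@[simp] theorem coe_unipDeltaSplit_fst (u : ↥(unipDelta L e dV hdV dW hdW)) :
    ((unipDeltaSplit L e dV hdV dW hdW u).1 : UnitaryGroup.arch (Fp L) L (IsCMField.complexConj L) (n + n) (hermD L e dV hdV dW hdW)) =
      UnitaryGroup.archPart (Fp L) L (IsCMField.complexConj L) (n + n) (hermD L e dV hdV dW hdW) u.1 :=
  rfl

/-- coordinates of `unipDeltaSplit`, finite places: `((unipDeltaSplit u).2)_v = u_v`. [cite: BorelJacquet1979, §4.1] -/
@[simp] theorem coe_unipDeltaSplit_snd_apply (u : ↥(unipDelta L e dV hdV dW hdW)) (v : HeightOneSpectrum (𝓞 (Fp L))) :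
    (((unipDeltaSplit L e dV hdV dW hdW u).2 v : ↥(unipDeltaLoc L e dV hdV dW hdW v)) :
        UnitaryGroup.localPi L (IsCMField.complexConj L) (n + n) (hermD L e dV hdV dW hdW) v) =
      UnitaryGroup.evalPlace (Fp L) L (IsCMField.complexConj L) (n + n) (hermD L e dV hdV dW hdW) v
        (UnitaryGroup.finPart (Fp L) L (IsCMField.complexConj L) (n + n) (hermD L e dV hdV dW hdW) u.1) :=
  rfl

set_option maxHeartbeats 400000 in
/-- the inverse of `unipDeltaSplit` on underlying elements: `unipDeltaSplit⁻¹ (a, y) = (a, 1)·(1, unipDeltaFinSplit⁻¹ y)`. [cite: BorelJacquet1979, §4.1] -/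
theorem coe_unipDeltaSplit_symm_apply
    (p : ↥(unipDeltaArch L e dV hdV dW hdW) ×
      Πʳ v : HeightOneSpectrum (𝓞 (Fp L)),
        [↥(unipDeltaLoc L e dV hdV dW hdW v),
          inH (fun v => UnitaryGroup.localInt L (IsCMField.complexConj L) (n + n) (hermD L e dV hdV dW hdW) v)
            (fun v => unipDeltaLoc L e dV hdV dW hdW v) v]) :
    (((unipDeltaSplit L e dV hdV dW hdW).symm p : ↥(unipDelta L e dV hdV dW hdW)) : HA L e dV hdV dW hdW) =
      UnitaryGroup.archToAdelic (Fp L) L (IsCMField.complexConj L) (n + n) (hermD L e dV hdV dW hdW) p.1.1 *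
        UnitaryGroup.finAdelicToAdelic (Fp L) L (IsCMField.complexConj L) (n + n) (hermD L e dV hdV dW hdW)
          (((unipDeltaFinSplit L e dV hdV dW hdW).symm p.2 : ↥(unipDeltaFin L e dV hdV dW hdW)) :
            UnitaryGroup.finAdelic (Fp L) L (IsCMField.complexConj L) (n + n) (hermD L e dV hdV dW hdW)) :=
  rfl

end Summit.HodgeConjecture.HodgeConjecture.Cruxes.HLiu418.K2LiuSiegelUnipotentSplitDefs

end
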